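import Literature.AlgebraicGeometry.Motives.HodgeDecompositionIsInternalDischarge
import Literature.NumberTheory.Transcendental.ComplexFormsPullback
import Literature.Geometry.Kaehler.ManifoldFormsPullback
import HarnessLib

/-!
# Stub `stub_hodgeTypeDescent` (line `purity-sorted-hecke-envelope` of crux
# `EndoscopicMiddleDegree.OrthogonalEnveloped`, stmt-HodgeConjecture-14300): Hodge types descend
# along holomorphic maps injective in cohomology

Registered skeleton `Cruxes/OrthogonalEnveloped/Lines/purity_sorted_hecke_envelope.lean` (rev c6-L1,
Stub L5); this is the file `Theorems/EndoscopicMiddleDegreeOrthogonalEnvelopedHodgeTypeDescent.lean`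
of the summit (`--supports stmt-HodgeConjecture-14300`).

WHAT IS PROVED (`stub_hodgeTypeDescent`, signature byte-identical with the registered stub). Let
`M`, `L` be compact Hausdorff Kähler manifolds charted on the same finite-dimensional complex
normed space `E`, `e` a NATURAL complex de Rham comparison family over `E`-manifolds
(`ComplexDeRhamIsoFamily`, `ComplexDeRhamIsoFamily.IsNatural`), `f : L → M` holomorphic with
`f^*` injective on `Hᵏ(-; ℂ)`. If `f^* u ∈ e_L(H^{p,q}(L))` then `u ∈ e_M(H^{p,q}(M))`.

HOW (Voisin, *Hodge Theory and Complex Algebraic Geometry I*, §7.3.1–§7.3.2: `f^*` is a morphism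
of Hodge structures, and a morphism of Hodge structures is strict). Transport everything to complex
de Rham cohomology through the linear equivalences `e_M`, `e_L` and naturality
(`e_L (f^*_{dR} c) = f^* (e_M c)`): `G := f^*_{dR} = complexDeRhamCohomology.map E _ k` is
injective, maps `H^{a,b}(M)` into `H^{a,b}(L)` (`map_mem_hodgePQ`, `f` being real-`C^∞` by
`MDifferentiable.contMDiff_real_of_complex`), and `G c ∈ H^{p,q}(L)` for `c := e_M⁻¹ u`. If
`p + q ≠ k` then `H^{p,q}(L) = 0` (`hodgePQ_eq_bot_of_ne`), so `G c = 0`, `c = 0`. Otherwise both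
families `(H^{a,b})_{a+b=k}` are internal direct sum decompositions
(`Literature.AlgebraicGeometry.Motives.directSum_isInternal_hodgePQ`, the PROVED Hodge
decomposition), and the pure linear algebra `mem_of_map_mem_of_iSupIndep` concludes: write
`c = a + r` with `a ∈ H^{p,q}(M)` and `r ∈ ⨆_{(a',b') ≠ (p,q)} H^{a',b'}(M)` (spanning on `M`); then
`G r = G c - G a ∈ H^{p,q}(L)` and `G r ∈ ⨆_{(a',b') ≠ (p,q)} H^{a',b'}(L)`, so `G r = 0` by
independence on `L`, `r = 0` by injectivity, and `c = a ∈ H^{p,q}(M)`. No named facts.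
-/

noncomputable section

-- The crux-workfile namespace `Summit.<P>.<Sub>.Cruxes.…` repeats `HodgeConjecture` (single-conjunct summit).
set_option linter.dupNamespace false

namespace Summit.HodgeConjecture.HodgeConjecture.Cruxes.OrthogonalEnveloped.PuritySortedHeckeEnvelope

open scoped Manifold ContDiff
open Literature.AlgebraicTopology.SingularHomology
open Literature.NumberTheory.Transcendental (ComplexDeRhamIsoFamily complexDeRhamCohomology hodgePQ
  map_mem_hodgePQ hodgePQ_eq_bot_of_ne)
open Literature.Geometry.Kaehler (IsKaehlerManifold)

/-- **Strictness of an injective morphism of graded pieces** (the linear algebra behind Voisin I,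
§7.3.1: a morphism of Hodge structures injective on the underlying space is strict). Let
`G : V → W` be an injective linear map, `(A i)` submodules spanning `V`, `(B i)` independent
submodules of `W` with `G(A i) ⊆ B i`. If `G c ∈ B i` then `c ∈ A i`.
[cite: VoisinHodgeI2002, §7.3.1] -/
theorem mem_of_map_mem_of_iSupIndep {R : Type*} [Ring R] {V : Type*} [AddCommGroup V] [Module R V]
    {W : Type*} [AddCommGroup W] [Module R W] {ι : Type*} {A : ι → Submodule R V}
    {B : ι → Submodule R W} (hA : ⨆ i, A i = ⊤) (hB : iSupIndep B) {G : V →ₗ[R] W}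
    (hG : Function.Injective G) (hAB : ∀ i, ∀ x ∈ A i, G x ∈ B i) {i : ι} {c : V}
    (hc : G c ∈ B i) : c ∈ A i := by
  have hc' : c ∈ A i ⊔ ⨆ (j) (_ : j ≠ i), A j := by
    rw [← iSup_split_single A i, hA]
    exact Submodule.mem_top
  obtain ⟨a, ha, r, hr, rfl⟩ := Submodule.mem_sup.1 hc'
  -- `G r` lies in the pieces of index `≠ i` ...
  have hGr : G r ∈ ⨆ (j) (_ : j ≠ i), B j := by
    have hle : (⨆ (j) (_ : j ≠ i), A j) ≤ (⨆ (j) (_ : j ≠ i), B j).comap G :=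
      iSup₂_le fun j hj x hx ↦ Submodule.mem_comap.2
        (Submodule.mem_iSup_of_mem j (Submodule.mem_iSup_of_mem hj (hAB j x hx)))
    exact hle hr
  -- ... and in the piece of index `i`
  have hGr' : G r ∈ B i := by
    have h := Submodule.sub_mem _ hc (hAB i a ha)
    rwa [map_add, add_sub_cancel_left] at h
  have hr0 : r = 0 :=
    hG (((Submodule.disjoint_def.1 (hB i)) _ hGr' hGr).trans (map_zero G).symm)
  rw [hr0, add_zero]
  exact ha

/-- **REGISTERED STUB `stub_hodgeTypeDescent` (Stub L5) — Hodge types descend along holomorphic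
maps injective in cohomology** (e.g. finite coverings). Let `M`, `L` be compact Hausdorff Kähler
manifolds charted on the same finite-dimensional `E`, `e` a natural complex de Rham comparison
family over `E`-manifolds, `f : L → M` holomorphic with `f^*` injective on `Hᵏ(-; ℂ)`. If `f^* u`
lies in `e_L(H^{p,q}(L))` then `u` lies in `e_M(H^{p,q}(M))`: read through `e` (naturality) the
statement is about `f^*_{dR}`, which is injective and maps `H^{a,b}(M)` into `H^{a,b}(L)`
(`map_mem_hodgePQ`); decompose by the Hodge decomposition of `M`
(`Motives.directSum_isInternal_hodgePQ`, PROVED), compare components in the Hodge decomposition of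
`L` (same theorem) and conclude by injectivity (`mem_of_map_mem_of_iSupIndep`;
`hodgePQ_eq_bot_of_ne` disposes of `p + q ≠ k`). Voisin: `φ^*` is a morphism of Hodge structures,
and a morphism of Hodge structures injective on the lattice is strict.
[cite: VoisinHodgeI2002, §7.3.1 and §7.3.2] -/
theorem stub_hodgeTypeDescent :
    ∀ {E : Type} [NormedAddCommGroup E] [NormedSpace ℂ E] [FiniteDimensional ℂ E]
      {M : Type} [TopologicalSpace M] [ChartedSpace E M] [IsManifold 𝓘(ℂ, E) ω M]
      [IsManifold 𝓘(ℝ, E) ∞ M] [T2Space M] [CompactSpace M] [IsKaehlerManifold E M]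
      {L : Type} [TopologicalSpace L] [ChartedSpace E L] [IsManifold 𝓘(ℂ, E) ω L]
      [IsManifold 𝓘(ℝ, E) ∞ L] [T2Space L] [CompactSpace L] [IsKaehlerManifold E L]
      (e : ComplexDeRhamIsoFamily E), e.IsNatural →
      ∀ {f : L → M} (hf : MDifferentiable 𝓘(ℂ, E) 𝓘(ℂ, E) f) (k p q : ℕ),
        Function.Injective (singularCohomology.map ℂ ℂ ⟨f, hf.continuous⟩ k) →
        ∀ u : singularCohomology ℂ ℂ M k,
          singularCohomology.map ℂ ℂ ⟨f, hf.continuous⟩ k u ∈ (hodgePQ E L k p q).map (e L k).toLinearMap →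
          u ∈ (hodgePQ E M k p q).map (e M k).toLinearMap := by
  intro E _ _ _ M _ _ _ _ _ _ _ L _ _ _ _ _ _ _ e he f hf k p q hinj u hu
  haveI : CompleteSpace E := FiniteDimensional.complete ℂ E
  -- `f` is real-`C^∞`, so it acts on complex de Rham cohomology
  have hfr : ContMDiff 𝓘(ℝ, E) 𝓘(ℝ, E) ∞ f := hf.contMDiff_real_of_complex
  -- naturality of the comparison: `e_L (f^*_{dR} c) = f^* (e_M c)`
  have hnat : ∀ c : complexDeRhamCohomology E M k,
      e L k (complexDeRhamCohomology.map E hfr k c) =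
        singularCohomology.map ℂ ℂ ⟨f, hf.continuous⟩ k (e M k c) :=
    fun c ↦ he L M f hfr k c
  -- `f^*_{dR}` is injective
  have hG : Function.Injective (complexDeRhamCohomology.map E hfr k) := fun c₁ c₂ h ↦
    (e M k).injective (hinj (((hnat c₁).symm.trans ((congrArg (e L k) h).trans (hnat c₂)))))
  -- `f^*_{dR}` preserves every Hodge type
  have hGpq : ∀ a b, ∀ x ∈ hodgePQ E M k a b,
      complexDeRhamCohomology.map E hfr k x ∈ hodgePQ E L k a b :=
    fun a b x hx ↦ map_mem_hodgePQ hfr hf hx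
  -- read `u = e_M c`
  obtain ⟨c, rfl⟩ := (e M k).surjective u
  have hc : complexDeRhamCohomology.map E hfr k c ∈ hodgePQ E L k p q := by
    obtain ⟨y, hy, hye⟩ := Submodule.mem_map.1 hu
    have hy' : e L k y = e L k (complexDeRhamCohomology.map E hfr k c) := by
      rw [hnat]
      exact hye
    exact (e L k).injective hy' ▸ hy
  suffices hcM : c ∈ hodgePQ E M k p q from Submodule.mem_map_of_mem hcM
  by_cases hpq : p + q = k
  · -- both Hodge decompositions are internal direct sums (PROVED in the tree)
    have hA := Literature.AlgebraicGeometry.Motives.directSum_isInternal_hodgePQ (E := E) (M := M) k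
    have hB := Literature.AlgebraicGeometry.Motives.directSum_isInternal_hodgePQ (E := E) (M := L) k
    exact mem_of_map_mem_of_iSupIndep
      (A := fun pq : ↥(Finset.antidiagonal k) ↦ hodgePQ E M k pq.1.1 pq.1.2)
      (B := fun pq : ↥(Finset.antidiagonal k) ↦ hodgePQ E L k pq.1.1 pq.1.2)
      hA.submodule_iSup_eq_top hB.submodule_iSupIndep hG (fun pq x hx ↦ hGpq _ _ x hx)
      (i := ⟨(p, q), Finset.mem_antidiagonal.2 hpq⟩) hc
  · -- no `k`-classes of type `(p, q)`: `f^*_{dR} c = 0`, hence `c = 0`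
    rw [hodgePQ_eq_bot_of_ne hpq, Submodule.mem_bot] at hc
    have h0 : c = 0 := hG (by rw [hc, map_zero])
    rw [h0]
    exact Submodule.zero_mem _

end Summit.HodgeConjecture.HodgeConjecture.Cruxes.OrthogonalEnveloped.PuritySortedHeckeEnvelope

end
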